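import Literature.Probability.Distributions.PoissonBinomialTilting
import HarnessLib

/-!
# The consecutive-atom ratio of a hypergeometric law on a window around the mean:
# `|1 − λ(x)|, |1 − λ(x)⁻¹| ≤ 4(N+2)(L+1)/W ≤ 8(L+1)/V`, two-sided geometric envelopes, and the window lower bound

Measure-free facts about the hypergeometric law in the generating-polynomial currency of the tree,
`H_{b,d,r} = Σ_k C(b,k)C(d,r−k)X^k` (`StablePolynomials.hyperGen`; `h(k) = coeff_k H_{b,d,r}/C(b+d,r)` is the
law of the number of marked items in a uniform `r`-subset of `b` marked and `d` unmarked items), continuing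
`PoissonBinomialTilting.lean` §9–§11. Throughout `N = b + d`, `μ = rb/N` is the mean,
`W = r·b·d·(N−r)/N² = (N−1)·V` with `V = rbd(N−r)/(N²(N−1))` the variance, and
`λ(x) = (x+1)(d−r+x+1)/((b−x)(r−x)) = h(x)/h(x+1)` is the consecutive-atom ratio of the tree
(`coeff_hyperGen_div_coeff_succ`; the printed recurrence `f(x)/f(x−1) = (n−x+1)(k−x+1)/[x(N−n−k+x)]`
and mode `⌊(k+1)(n+1)/(N+2)⌋` of [Chattamvelli–Shanmugam 2020, §7.4 Table 7.1]).

* §1 **the ratio, exactly** (`one_sub_hyperRatio_eq`, `one_sub_hyperRatio_inv_eq`):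
  `1 − λ(x) = −((N+2)(x−μ) + (2μ+d−r+1))/((b−x)(r−x))` and
  `1 − λ(x)⁻¹ = ((N+2)(x−μ) + (2μ+d−r+1))/((x+1)(d−r+x+1))` — the numerator is AFFINE in `x` with slope
  `N+2` and vanishes at `x* = μ − (2μ+d−r+1)/(N+2) ∈ (μ−1, μ]`, the printed mode formula; and the centre
  identities `(b−μ)(r−μ) = W = μ(d−r+μ)` (`sub_mean_mul_sub_mean_eq`, `mean_mul_eq`): AT the mean both
  denominators equal `(N−1)·V`; `margins_eq`: `b−μ = b(N−r)/N`, `r−μ = rd/N`, `d−r+μ = d(N−r)/N`.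
* §2 **the window** `|x − μ| ≤ L` with margins `2(L+1) ≤ b−μ, r−μ, μ, d−r+μ` (the central halves of the four
  distances from the mean to the ends of the support rectangle): `window_support` (such `x` has
  `x+2 ≤ b`, `x+2 ≤ r`, `r+2 ≤ d+x`, so `λ(x)` is the tree's ratio of two positive atoms), and THE BOUNDS
  **`abs_one_sub_hyperRatio_le`**, **`abs_one_sub_hyperRatio_inv_le`**:
  `|1 − λ(x)|, |1 − λ(x)⁻¹| ≤ 4(N+2)(L+1)/W`, with the variance forms `…_le_var`: `≤ 8(L+1)/V`
  (the margins force `N ≥ 8`). Mechanism: numerator `≤ (N+2)L + (N+1) ≤ (N+2)(L+1)`, denominators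
  `≥ ((b−μ)/2)((r−μ)/2) = W/4` resp. `≥ (μ/2)((d−r+μ)/2) = W/4`.
* §3 **two-sided geometric envelopes inside the window** (`coeff_hyperGen_succ_le_of_window`,
  `coeff_hyperGen_le_succ_of_window`, **`coeff_hyperGen_window_envelope`**): with `η = 4(N+2)(L+1)/W`, for
  `x ≤ x'` both in the window, `h(x') ≤ (1+η)^{x'−x}·h(x)` and `h(x) ≤ (1+η)^{x'−x}·h(x')` — one-step ratio
  bounds iterated inside the interval (no log-concavity needed).
* §4 `le_min_hyperRatio_inv_mul` : `V/(1+η) ≤ min(λ(x), λ(x)⁻¹)·V` — the effective variance `V'` of the tilted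
  law in `hyperGen_abs_nabla_even_le`.
* §5 **the window lower bound** (`coeff_hyperGen_window_lower`): for `2 ≤ L` and every natural `n₀ ≥ L + 2`,
  `C(N,r)·3/(8(2√V+1)) ≤ (1+η)^{n₀}·coeff_x H_{b,d,r}` at every `x` in the window — the max atom is
  `≥ 3/(8(2√V+1))` in law units (`exists_max_pmf_ge` through the Bernoulli-sum representation
  `exists_bernoulliProd_eq_hyperGen`), every maximiser is within `2` of the mean (`hyperGen_argmax_near_mean`),
  hence inside the window, and §3 connects it to `x`.
* §6 (v2) **outside the window** (`abs_coeff_one_sub_X_pow_mul_le_sum`, `…_le_two_pow_mul_upperTail`,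
  `…_le_two_pow_mul_lowerTail`, `hyperGen_abs_nabla_le_two_pow_mul_tail`): for ANY polynomial with nonnegative
  coefficients, `|coeff_n((1−X)^m P)| ≤ Σ_i C(m,i) coeff_{n−i} P ≤ 2^m·(upper tail mass from τ)` when `τ ≤ n − m`
  (resp. `2^m·(lower tail mass up to τ)` when `n ≤ τ`) — the ABSOLUTE bound for the bad components, in the
  filter-set shape of `hyperGen_upperTail_le_exp` / `hyperGen_lowerTail_le_exp`.
* (v3) `margins_ge_of_typeMargins` (§1): `b, d, r, N−r ≥ βN ⇒` all four margins `≥ β²N` — the window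
  hypotheses of §2–§5 from type margins in one call. (The off-centre window form of the relative bound and the
  far stencil are prover g24's `HypergeometricStencilBounds.lean`, which imports this file.)

These are the inputs `η = 8(L_h+2)/V_h` «on the central half of the range», the `x`-shift comparability
`law(x') ≤ (1+η)^{|x'−x|}·law(x)` of good components, and the window lower bound of cell pnp-psdrank's
[BULK] blueprint (prover MEMO-26 §7 Steps 3, 5, 6) for the hypergeometric components
`H_{b_Y,d_Y,s−α}` of a shell law (`ShellLawGeneratingPolynomial.shellGen_eq_sum_halfSets_hyperGen`) and for
the hypergeometric mixing law of `α`; nothing here is specific to that cell.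
All PROVED, 0 sorry, no definitions, no named facts; finite real algebra.

## References
* [ChattamvelliShanmugam2020] R. Chattamvelli, R. Shanmugam, *Discrete Distributions in Engineering and the
  Applied Sciences* (2020), Ch. 7, §7.4 Table 7.1 p. 143 (hypergeometric law: mean `nk/N`, variance,
  mode `⌊(k+1)(n+1)/(N+2)⌋`, recurrence `f(x)/f(x−1) = (n−x+1)(k−x+1)/[x(N−n−k+x)]`).
* [Karlin1968] S. Karlin, *Total Positivity I* (1968), Ch. 8 §1 (ratio monotonicity of `PF₂` sequences —
  not used: inside the window the one-step bounds suffice).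
* [VatutinMikhailov1983] V. A. Vatutin, V. G. Mikhailov, Theory Probab. Appl. 27 (1983) 734–743, §2 (the
  hypergeometric law is a Bernoulli sum; used in §5 through the tree's `exists_bernoulliProd_eq_hyperGen`).
* [Durrett2019] R. Durrett, *Probability: Theory and Examples*, 5th ed. (2019), Thm. 1.6.4 (Chebyshev; the
  max-atom bound of `PoissonBinomialTilting` §3 used in §5).
* [RollinRoss2010] A. Röllin, N. Ross, *Local limit theorems via Landau–Kolmogorov inequalities*, Bernoulli 21
  (2015) 851–880, §3 Lemma 3.1 (differences of a lattice law as coefficients of `(1−X)^m·P`; §6).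
-/

namespace Literature.Probability.Distributions

open Finset Polynomial
open Literature.Combinatorics.StablePolynomials (coeff_bernoulliProd_eq_pmf hyperGen coeff_hyperGen
  coeff_hyperGen_nonneg natDegree_hyperGen_le exists_bernoulliProd_eq_hyperGen sum_mul_one_sub_eq_of_hyperGen_eq
  eval_one_hyperGen)

namespace PoissonBinomial

/-! ## §1 The ratio, exactly: an affine numerator over the two denominators; the centre identities -/

/-- **`1 − λ(x)` exactly**: with `λ(x) = (x+1)(d−r+x+1)/((b−x)(r−x))`, `N = b+d > 0` and `μ = rb/N`,
`1 − λ(x) = −((N+2)(x−μ) + (2μ+d−r+1))/((b−x)(r−x))` whenever `x ≠ b`, `x ≠ r`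
(numerator `(b−x)(r−x) − (x+1)(d−r+x+1) = br − (d−r+1) − (N+2)x` and `Nμ = rb`).
[cite: ChattamvelliShanmugam2020, §7.4 Table 7.1 (recurrence and mode of the hypergeometric law)] -/
theorem one_sub_hyperRatio_eq {b d r x : ℕ} {μ l : ℝ} (hN : 0 < b + d)
    (hμ : μ = (r : ℝ) * b / ((b : ℝ) + d))
    (hl : l = ((x : ℝ) + 1) * ((d : ℝ) - r + x + 1) / (((b : ℝ) - x) * ((r : ℝ) - x)))
    (hxb : (x : ℝ) ≠ b) (hxr : (x : ℝ) ≠ r) :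
    1 - l = -((((b : ℝ) + d + 2) * ((x : ℝ) - μ) + (2 * μ + d - r + 1)) /
      (((b : ℝ) - x) * ((r : ℝ) - x))) := by
  have hNR : (0 : ℝ) < (b : ℝ) + d := by exact_mod_cast hN
  have hbx : (b : ℝ) - x ≠ 0 := sub_ne_zero.2 (Ne.symm hxb)
  have hrx : (r : ℝ) - x ≠ 0 := sub_ne_zero.2 (Ne.symm hxr)
  rw [hl, hμ]
  field_simp
  ring

/-- **`1 − λ(x)⁻¹` exactly**: `1 − λ(x)⁻¹ = ((N+2)(x−μ) + (2μ+d−r+1))/((x+1)(d−r+x+1))` whenever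
`(x+1)(d−r+x+1) ≠ 0` — the same affine numerator over the other denominator.
[cite: ChattamvelliShanmugam2020, §7.4 Table 7.1 (recurrence and mode of the hypergeometric law)] -/
theorem one_sub_hyperRatio_inv_eq {b d r x : ℕ} {μ l : ℝ} (hN : 0 < b + d)
    (hμ : μ = (r : ℝ) * b / ((b : ℝ) + d))
    (hl : l = ((x : ℝ) + 1) * ((d : ℝ) - r + x + 1) / (((b : ℝ) - x) * ((r : ℝ) - x)))
    (hden : ((x : ℝ) + 1) * ((d : ℝ) - r + x + 1) ≠ 0) :
    1 - l⁻¹ = (((b : ℝ) + d + 2) * ((x : ℝ) - μ) + (2 * μ + d - r + 1)) /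
      (((x : ℝ) + 1) * ((d : ℝ) - r + x + 1)) := by
  have hNR : (0 : ℝ) < (b : ℝ) + d := by exact_mod_cast hN
  obtain ⟨hx1, hd1⟩ := mul_ne_zero_iff.1 hden
  rw [hl, hμ, inv_div]
  field_simp
  ring

/-- **Centre identity, upper side**: `(b − μ)(r − μ) = r·b·d·(N−r)/N²` (`= (N−1)·Var`) for `μ = rb/N`, `N = b+d > 0`:
the denominator of `λ` AT the mean. [cite: ChattamvelliShanmugam2020, §7.4 Table 7.1 (mean nk/N, variance)] -/
theorem sub_mean_mul_sub_mean_eq {b d r : ℕ} {μ : ℝ} (hN : 0 < b + d)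
    (hμ : μ = (r : ℝ) * b / ((b : ℝ) + d)) :
    ((b : ℝ) - μ) * ((r : ℝ) - μ) = (r : ℝ) * b * d * ((b : ℝ) + d - r) / ((b : ℝ) + d) ^ 2 := by
  have hNR : (0 : ℝ) < (b : ℝ) + d := by exact_mod_cast hN
  rw [hμ]
  field_simp
  ring

/-- **Centre identity, lower side**: `μ·(d − r + μ) = r·b·d·(N−r)/N²` for `μ = rb/N`, `N = b+d > 0`: the
denominator of `λ⁻¹` AT the mean (`d − r + μ = d(N−r)/N`).
[cite: ChattamvelliShanmugam2020, §7.4 Table 7.1 (mean nk/N, variance)] -/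
theorem mean_mul_eq {b d r : ℕ} {μ : ℝ} (hN : 0 < b + d)
    (hμ : μ = (r : ℝ) * b / ((b : ℝ) + d)) :
    μ * ((d : ℝ) - r + μ) = (r : ℝ) * b * d * ((b : ℝ) + d - r) / ((b : ℝ) + d) ^ 2 := by
  have hNR : (0 : ℝ) < (b : ℝ) + d := by exact_mod_cast hN
  rw [hμ]
  field_simp
  ring

/-- **The four distances from the mean to the ends of the support rectangle, in closed form**: for `μ = rb/N`,
`N = b+d > 0`: `b − μ = b(N−r)/N`, `r − μ = rd/N`, `d − r + μ = d(N−r)/N` (and `μ = rb/N`). With type margins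
`b, d ≥ βN` and `r, N−r ≥ βN` all four are `≥ β²N`, which is how the window hypotheses of §2 are met.
[cite: ChattamvelliShanmugam2020, §7.4 Table 7.1 (range and mean of the hypergeometric law)] -/
theorem margins_eq {b d r : ℕ} {μ : ℝ} (hN : 0 < b + d)
    (hμ : μ = (r : ℝ) * b / ((b : ℝ) + d)) :
    (b : ℝ) - μ = (b : ℝ) * ((b : ℝ) + d - r) / ((b : ℝ) + d) ∧
      (r : ℝ) - μ = (r : ℝ) * d / ((b : ℝ) + d) ∧
        (d : ℝ) - r + μ = (d : ℝ) * ((b : ℝ) + d - r) / ((b : ℝ) + d) := by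
  have hNR : (0 : ℝ) < (b : ℝ) + d := by exact_mod_cast hN
  refine ⟨?_, ?_, ?_⟩ <;> (rw [hμ]; field_simp) <;> ring

/-- **The four margins are `≥ β²N` under type margins**: if `b, d, r, N−r ≥ βN` (`N = b+d`, `β > 0`) then
`b−μ, r−μ, μ, d−r+μ ≥ β²N` — so the window hypotheses of §2–§5 hold as soon as `2(L+1) ≤ β²N`
(cell pnp-psdrank: the type margins of `ShellLawTypeBounds.hypVar_ge`).
[cite: ChattamvelliShanmugam2020, §7.4 Table 7.1 (range and mean of the hypergeometric law)] -/
theorem margins_ge_of_typeMargins {b d r : ℕ} {μ β : ℝ} (hβ : 0 < β)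
    (hb : β * ((b : ℝ) + d) ≤ b) (hd : β * ((b : ℝ) + d) ≤ d) (hr : β * ((b : ℝ) + d) ≤ r)
    (hr' : (r : ℝ) + β * ((b : ℝ) + d) ≤ (b : ℝ) + d) (hμ : μ = (r : ℝ) * b / ((b : ℝ) + d)) :
    β ^ 2 * ((b : ℝ) + d) ≤ (b : ℝ) - μ ∧ β ^ 2 * ((b : ℝ) + d) ≤ (r : ℝ) - μ ∧
      β ^ 2 * ((b : ℝ) + d) ≤ μ ∧ β ^ 2 * ((b : ℝ) + d) ≤ (d : ℝ) - r + μ := by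
  rcases Nat.eq_zero_or_pos (b + d) with hN0 | hN
  · -- degenerate `N = 0`: then `b = d = r = 0`, `μ = 0`, and every margin is `0 ≥ β²·0`
    have hb0 : b = 0 := by omega
    have hd0 : d = 0 := by omega
    subst hb0; subst hd0
    have hr0 : (r : ℝ) ≤ 0 := by push_cast at hr'; linarith
    have hr00 : r = 0 := by exact_mod_cast le_antisymm hr0 (Nat.cast_nonneg r)
    subst hr00
    rw [hμ]; simp
  have hN0 : (0 : ℝ) < (b : ℝ) + d := by exact_mod_cast hN
  obtain ⟨h1, h2, h3⟩ := margins_eq hN hμ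
  have hβN : 0 ≤ β * ((b : ℝ) + d) := by positivity
  have key : ∀ {x y : ℝ}, β * ((b : ℝ) + d) ≤ x → β * ((b : ℝ) + d) ≤ y →
      β ^ 2 * ((b : ℝ) + d) ≤ x * y / ((b : ℝ) + d) := by
    intro x y hx hy
    rw [le_div_iff₀ hN0]
    have := mul_le_mul hx hy hβN (hβN.trans hx)
    nlinarith
  refine ⟨?_, ?_, ?_, ?_⟩
  · rw [h1]; exact key hb (by linarith)
  · rw [h2]; exact key hr hd
  · rw [hμ]; exact key hr hb
  · rw [h3]; exact key hd (by linarith)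

/-! ## §2 The window around the mean and the ratio bounds -/

/-- **A window point lies well inside the support rectangle**: if `|x − μ| ≤ L` and
`2(L+1) ≤ b−μ, r−μ, d−r+μ`, then `x + 2 ≤ b`, `x + 2 ≤ r` and `r + 2 ≤ d + x` — in particular `λ(x)` is the
ratio of two positive atoms (`coeff_hyperGen_div_coeff_succ` applies at `x` and at `x+1`).
[cite: ChattamvelliShanmugam2020, §7.4 Table 7.1 (range of the hypergeometric law)] -/
theorem window_support {b d r x : ℕ} {μ L : ℝ} (hx : |(x : ℝ) - μ| ≤ L)
    (hbm : 2 * (L + 1) ≤ (b : ℝ) - μ) (hrm : 2 * (L + 1) ≤ (r : ℝ) - μ)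
    (hdm : 2 * (L + 1) ≤ (d : ℝ) - r + μ) :
    x + 2 ≤ b ∧ x + 2 ≤ r ∧ r + 2 ≤ d + x := by
  have hL : 0 ≤ L := (abs_nonneg _).trans hx
  obtain ⟨h1, h2⟩ := abs_le.1 hx
  refine ⟨?_, ?_, ?_⟩
  · have : (x : ℝ) + 2 ≤ b := by linarith
    exact_mod_cast this
  · have : (x : ℝ) + 2 ≤ r := by linarith
    exact_mod_cast this
  · have : (r : ℝ) + 2 ≤ (d : ℝ) + x := by linarith
    exact_mod_cast this

/-- The affine numerator on the window: `|(N+2)(x−μ) + (2μ+d−r+1)| ≤ (N+2)(L+1)` when `|x−μ| ≤ L`,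
`0 ≤ μ ≤ b`, `0 ≤ d−r+μ` and `μ ≤ r` (so that `0 ≤ 2μ+d−r+1 ≤ N+1`). [folklore] -/
private theorem abs_num_le {b d r x : ℕ} {μ L : ℝ} (hx : |(x : ℝ) - μ| ≤ L)
    (hμ0 : 0 ≤ μ) (hμb : μ ≤ b) (hμr : μ ≤ r) (hdm0 : 0 ≤ (d : ℝ) - r + μ) :
    |((b : ℝ) + d + 2) * ((x : ℝ) - μ) + (2 * μ + d - r + 1)| ≤ ((b : ℝ) + d + 2) * (L + 1) := by
  have hN2 : (0 : ℝ) ≤ (b : ℝ) + d + 2 := by positivity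
  calc |((b : ℝ) + d + 2) * ((x : ℝ) - μ) + (2 * μ + d - r + 1)|
      ≤ |((b : ℝ) + d + 2) * ((x : ℝ) - μ)| + |2 * μ + d - r + 1| := abs_add_le _ _
    _ ≤ ((b : ℝ) + d + 2) * L + ((b : ℝ) + d + 1) := by
        refine add_le_add ?_ ?_
        · rw [abs_mul, abs_of_nonneg hN2]
          exact mul_le_mul_of_nonneg_left hx hN2
        · rw [abs_of_nonneg (by linarith)]
          linarith
    _ ≤ ((b : ℝ) + d + 2) * (L + 1) := by nlinarith

/-- **THE RATIO BOUND ON THE WINDOW.** For the hypergeometric ratio `λ(x) = (x+1)(d−r+x+1)/((b−x)(r−x))`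
(`= coeff_x H_{b,d,r} / coeff_{x+1} H_{b,d,r}`, tree `coeff_hyperGen_div_coeff_succ`), `μ = rb/(b+d)`,
`W = rbd(b+d−r)/(b+d)²`: if `|x − μ| ≤ L` and `2(L+1) ≤ b−μ, r−μ, μ, d−r+μ`, then
`|1 − λ(x)| ≤ 4(N+2)(L+1)/W` (`N = b+d`). Numerator `≤ (N+2)(L+1)` (`abs_num_le`), denominator
`(b−x)(r−x) ≥ ((b−μ)/2)((r−μ)/2) = W/4`. [cite: ChattamvelliShanmugam2020, §7.4 Table 7.1 (recurrence, mean,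
variance, mode of the hypergeometric law)] -/
theorem abs_one_sub_hyperRatio_le {b d r x : ℕ} {μ L W l : ℝ}
    (hμ : μ = (r : ℝ) * b / ((b : ℝ) + d))
    (hW : W = (r : ℝ) * b * d * ((b : ℝ) + d - r) / ((b : ℝ) + d) ^ 2)
    (hl : l = ((x : ℝ) + 1) * ((d : ℝ) - r + x + 1) / (((b : ℝ) - x) * ((r : ℝ) - x)))
    (hx : |(x : ℝ) - μ| ≤ L)
    (hbm : 2 * (L + 1) ≤ (b : ℝ) - μ) (hrm : 2 * (L + 1) ≤ (r : ℝ) - μ)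
    (hμm : 2 * (L + 1) ≤ μ) (hdm : 2 * (L + 1) ≤ (d : ℝ) - r + μ) :
    |1 - l| ≤ 4 * ((b : ℝ) + d + 2) * (L + 1) / W := by
  have hL : 0 ≤ L := (abs_nonneg _).trans hx
  obtain ⟨h1, h2⟩ := abs_le.1 hx
  obtain ⟨hxb, hxr, _⟩ := window_support hx hbm hrm hdm
  have hN : 0 < b + d := by omega
  have hxbR : (x : ℝ) + 2 ≤ b := by exact_mod_cast hxb
  have hxrR : (x : ℝ) + 2 ≤ r := by exact_mod_cast hxr
  -- the centre identity `(b−μ)(r−μ) = W`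
  have hWc : ((b : ℝ) - μ) * ((r : ℝ) - μ) = W := by rw [hW]; exact sub_mean_mul_sub_mean_eq hN hμ
  -- the denominator is at least `W/4`
  have hD : W / 4 ≤ ((b : ℝ) - x) * ((r : ℝ) - x) := by
    have hb2 : ((b : ℝ) - μ) / 2 ≤ (b : ℝ) - x := by linarith
    have hr2 : ((r : ℝ) - μ) / 2 ≤ (r : ℝ) - x := by linarith
    have := mul_le_mul hb2 hr2 (by linarith) (by linarith)
    calc W / 4 = ((b : ℝ) - μ) / 2 * (((r : ℝ) - μ) / 2) := by rw [← hWc]; ring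
      _ ≤ _ := this
  have hW4 : 0 < W / 4 := by
    have : (L + 1) * (L + 1) ≤ W / 4 := by
      calc (L + 1) * (L + 1) ≤ ((b : ℝ) - μ) / 2 * (((r : ℝ) - μ) / 2) :=
            mul_le_mul (by linarith) (by linarith) (by linarith) (by linarith)
        _ = W / 4 := by rw [← hWc]; ring
    nlinarith
  have hDpos : 0 < ((b : ℝ) - x) * ((r : ℝ) - x) := hW4.trans_le hD
  -- the exact form of `1 − λ`
  have hid := one_sub_hyperRatio_eq hN hμ hl (by linarith) (by linarith)
  have hnum := abs_num_le (b := b) (d := d) (r := r) hx (by linarith) (by linarith) (by linarith) (by linarith)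
  rw [hid, abs_neg, abs_div, abs_of_pos hDpos]
  calc |((b : ℝ) + d + 2) * ((x : ℝ) - μ) + (2 * μ + d - r + 1)| / (((b : ℝ) - x) * ((r : ℝ) - x))
      ≤ ((b : ℝ) + d + 2) * (L + 1) / (((b : ℝ) - x) * ((r : ℝ) - x)) :=
        div_le_div_of_nonneg_right hnum hDpos.le
    _ ≤ ((b : ℝ) + d + 2) * (L + 1) / (W / 4) :=
        div_le_div_of_nonneg_left (by positivity) hW4 hD
    _ = 4 * ((b : ℝ) + d + 2) * (L + 1) / W := by
        field_simp

/-- **THE INVERSE-RATIO BOUND ON THE WINDOW**: under the same hypotheses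
`|1 − λ(x)⁻¹| ≤ 4(N+2)(L+1)/W` — same numerator, denominator `(x+1)(d−r+x+1) ≥ (μ/2)((d−r+μ)/2) = W/4`.
[cite: ChattamvelliShanmugam2020, §7.4 Table 7.1 (recurrence, mean, variance, mode of the hypergeometric law)] -/
theorem abs_one_sub_hyperRatio_inv_le {b d r x : ℕ} {μ L W l : ℝ}
    (hμ : μ = (r : ℝ) * b / ((b : ℝ) + d))
    (hW : W = (r : ℝ) * b * d * ((b : ℝ) + d - r) / ((b : ℝ) + d) ^ 2)
    (hl : l = ((x : ℝ) + 1) * ((d : ℝ) - r + x + 1) / (((b : ℝ) - x) * ((r : ℝ) - x)))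
    (hx : |(x : ℝ) - μ| ≤ L)
    (hbm : 2 * (L + 1) ≤ (b : ℝ) - μ) (hrm : 2 * (L + 1) ≤ (r : ℝ) - μ)
    (hμm : 2 * (L + 1) ≤ μ) (hdm : 2 * (L + 1) ≤ (d : ℝ) - r + μ) :
    |1 - l⁻¹| ≤ 4 * ((b : ℝ) + d + 2) * (L + 1) / W := by
  have hL : 0 ≤ L := (abs_nonneg _).trans hx
  obtain ⟨h1, h2⟩ := abs_le.1 hx
  obtain ⟨hxb, hxr, _⟩ := window_support hx hbm hrm hdm
  have hN : 0 < b + d := by omega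
  -- the centre identities
  have hWc : ((b : ℝ) - μ) * ((r : ℝ) - μ) = W := by rw [hW]; exact sub_mean_mul_sub_mean_eq hN hμ
  have hWc' : μ * ((d : ℝ) - r + μ) = W := by rw [hW]; exact mean_mul_eq hN hμ
  -- the denominator is at least `W/4`
  have hx0 : (0 : ℝ) ≤ x := Nat.cast_nonneg _
  have hD : W / 4 ≤ ((x : ℝ) + 1) * ((d : ℝ) - r + x + 1) := by
    have hb2 : μ / 2 ≤ (x : ℝ) + 1 := by linarith
    have hr2 : ((d : ℝ) - r + μ) / 2 ≤ (d : ℝ) - r + x + 1 := by linarith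
    have := mul_le_mul hb2 hr2 (by linarith) (by linarith)
    calc W / 4 = μ / 2 * (((d : ℝ) - r + μ) / 2) := by rw [← hWc']; ring
      _ ≤ _ := this
  have hW4 : 0 < W / 4 := by
    have : (L + 1) * (L + 1) ≤ W / 4 := by
      calc (L + 1) * (L + 1) ≤ ((b : ℝ) - μ) / 2 * (((r : ℝ) - μ) / 2) :=
            mul_le_mul (by linarith) (by linarith) (by linarith) (by linarith)
        _ = W / 4 := by rw [← hWc]; ring
    nlinarith
  have hDpos : 0 < ((x : ℝ) + 1) * ((d : ℝ) - r + x + 1) := hW4.trans_le hD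
  have hid := one_sub_hyperRatio_inv_eq hN hμ hl hDpos.ne'
  have hnum := abs_num_le (b := b) (d := d) (r := r) hx (by linarith) (by linarith) (by linarith) (by linarith)
  rw [hid, abs_div, abs_of_pos hDpos]
  calc |((b : ℝ) + d + 2) * ((x : ℝ) - μ) + (2 * μ + d - r + 1)| / (((x : ℝ) + 1) * ((d : ℝ) - r + x + 1))
      ≤ ((b : ℝ) + d + 2) * (L + 1) / (((x : ℝ) + 1) * ((d : ℝ) - r + x + 1)) :=
        div_le_div_of_nonneg_right hnum hDpos.le
    _ ≤ ((b : ℝ) + d + 2) * (L + 1) / (W / 4) :=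
        div_le_div_of_nonneg_left (by positivity) hW4 hD
    _ = 4 * ((b : ℝ) + d + 2) * (L + 1) / W := by
        field_simp

/-- `4(N+2)(L+1)/W ≤ 8(L+1)/V` for the variance `V = W/(N−1)`, as soon as `N ≥ 4` (here the margins force
`N ≥ 8`): the passage from the `W`-currency to the variance currency of `hyperGen_abs_nabla_even_le`. [folklore] -/
private theorem windowConst_le_var {b d r : ℕ} {μ L W V : ℝ}
    (hμ : μ = (r : ℝ) * b / ((b : ℝ) + d))
    (hW : W = (r : ℝ) * b * d * ((b : ℝ) + d - r) / ((b : ℝ) + d) ^ 2)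
    (hVdef : V = (r : ℝ) * b * d * ((b : ℝ) + d - r) / (((b : ℝ) + d) ^ 2 * ((b : ℝ) + d - 1)))
    (hL : 0 ≤ L) (hbm : 2 * (L + 1) ≤ (b : ℝ) - μ) (hrm : 2 * (L + 1) ≤ (r : ℝ) - μ)
    (hμm : 2 * (L + 1) ≤ μ) (hdm : 2 * (L + 1) ≤ (d : ℝ) - r + μ) :
    4 * ((b : ℝ) + d + 2) * (L + 1) / W ≤ 8 * (L + 1) / V := by
  -- `b ≥ 4` and `d ≥ 4`
  have hb4 : (4 : ℝ) ≤ b := by linarith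
  have hd4 : (4 : ℝ) ≤ d := by
    have : (r : ℝ) - μ + ((d : ℝ) - r + μ) = d := by ring
    linarith
  have hN : 0 < b + d := by
    have : (0 : ℝ) < (b : ℝ) + d := by linarith
    exact_mod_cast this
  have hWc : ((b : ℝ) - μ) * ((r : ℝ) - μ) = W := by rw [hW]; exact sub_mean_mul_sub_mean_eq hN hμ
  have hWpos : 0 < W := by
    have : (L + 1) * (L + 1) ≤ ((b : ℝ) - μ) * ((r : ℝ) - μ) :=
      mul_le_mul (by linarith) (by linarith) (by linarith) (by linarith)
    nlinarith
  have hN1 : (0 : ℝ) < (b : ℝ) + d - 1 := by linarith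
  have hVW : V = W / ((b : ℝ) + d - 1) := by
    rw [hVdef, hW, div_div]
  have hVpos : 0 < V := by rw [hVW]; exact div_pos hWpos hN1
  rw [hVW, div_le_div_iff₀ hWpos (div_pos hWpos hN1)]
  -- `4(N+2)(L+1)·(W/(N−1)) ≤ 8(L+1)·W` ⟸ `(N+2) ≤ 2(N−1)`
  have key : 4 * ((b : ℝ) + d + 2) ≤ 8 * ((b : ℝ) + d - 1) := by linarith
  have h1 : 4 * ((b : ℝ) + d + 2) * (L + 1) * (W / ((b : ℝ) + d - 1)) =
      4 * ((b : ℝ) + d + 2) * ((L + 1) * W / ((b : ℝ) + d - 1)) := by ring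
  have h2 : 8 * (L + 1) * W = 8 * ((b : ℝ) + d - 1) * ((L + 1) * W / ((b : ℝ) + d - 1)) := by
    field_simp
  rw [h1, h2]
  exact mul_le_mul_of_nonneg_right key (div_nonneg (mul_nonneg (by linarith) hWpos.le) hN1.le)

/-- **The ratio bound in variance currency**: under the window hypotheses, with the hypergeometric variance
`V = rbd(b+d−r)/((b+d)²(b+d−1))` (the `V` of `hyperGen_abs_nabla_even_le`), `|1 − λ(x)| ≤ 8(L+1)/V`.
[cite: ChattamvelliShanmugam2020, §7.4 Table 7.1 (recurrence, mean, variance of the hypergeometric law)] -/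
theorem abs_one_sub_hyperRatio_le_var {b d r x : ℕ} {μ L V l : ℝ}
    (hμ : μ = (r : ℝ) * b / ((b : ℝ) + d))
    (hVdef : V = (r : ℝ) * b * d * ((b : ℝ) + d - r) / (((b : ℝ) + d) ^ 2 * ((b : ℝ) + d - 1)))
    (hl : l = ((x : ℝ) + 1) * ((d : ℝ) - r + x + 1) / (((b : ℝ) - x) * ((r : ℝ) - x)))
    (hx : |(x : ℝ) - μ| ≤ L)
    (hbm : 2 * (L + 1) ≤ (b : ℝ) - μ) (hrm : 2 * (L + 1) ≤ (r : ℝ) - μ)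
    (hμm : 2 * (L + 1) ≤ μ) (hdm : 2 * (L + 1) ≤ (d : ℝ) - r + μ) :
    |1 - l| ≤ 8 * (L + 1) / V :=
  (abs_one_sub_hyperRatio_le hμ rfl hl hx hbm hrm hμm hdm).trans
    (windowConst_le_var hμ rfl hVdef ((abs_nonneg _).trans hx) hbm hrm hμm hdm)

/-- **The inverse-ratio bound in variance currency**: under the window hypotheses, `|1 − λ(x)⁻¹| ≤ 8(L+1)/V`.
[cite: ChattamvelliShanmugam2020, §7.4 Table 7.1 (recurrence, mean, variance of the hypergeometric law)] -/
theorem abs_one_sub_hyperRatio_inv_le_var {b d r x : ℕ} {μ L V l : ℝ}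
    (hμ : μ = (r : ℝ) * b / ((b : ℝ) + d))
    (hVdef : V = (r : ℝ) * b * d * ((b : ℝ) + d - r) / (((b : ℝ) + d) ^ 2 * ((b : ℝ) + d - 1)))
    (hl : l = ((x : ℝ) + 1) * ((d : ℝ) - r + x + 1) / (((b : ℝ) - x) * ((r : ℝ) - x)))
    (hx : |(x : ℝ) - μ| ≤ L)
    (hbm : 2 * (L + 1) ≤ (b : ℝ) - μ) (hrm : 2 * (L + 1) ≤ (r : ℝ) - μ)
    (hμm : 2 * (L + 1) ≤ μ) (hdm : 2 * (L + 1) ≤ (d : ℝ) - r + μ) :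
    |1 - l⁻¹| ≤ 8 * (L + 1) / V :=
  (abs_one_sub_hyperRatio_inv_le hμ rfl hl hx hbm hrm hμm hdm).trans
    (windowConst_le_var hμ rfl hVdef ((abs_nonneg _).trans hx) hbm hrm hμm hdm)

/-! ## §3 Two-sided geometric envelopes inside the window -/

/-- **One step up inside the window**: with `η = 4(N+2)(L+1)/W`, at every window point `x`,
`coeff_{x+1} H_{b,d,r} ≤ (1+η)·coeff_x H_{b,d,r}` (`coeff_{x+1} = λ(x)⁻¹·coeff_x` and `λ(x)⁻¹ ≤ 1 + |1−λ(x)⁻¹|`).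
[cite: ChattamvelliShanmugam2020, §7.4 Table 7.1 (recurrence of the hypergeometric law)] -/
theorem coeff_hyperGen_succ_le_of_window {b d r x : ℕ} {μ L W : ℝ}
    (hμ : μ = (r : ℝ) * b / ((b : ℝ) + d))
    (hW : W = (r : ℝ) * b * d * ((b : ℝ) + d - r) / ((b : ℝ) + d) ^ 2)
    (hx : |(x : ℝ) - μ| ≤ L)
    (hbm : 2 * (L + 1) ≤ (b : ℝ) - μ) (hrm : 2 * (L + 1) ≤ (r : ℝ) - μ)
    (hμm : 2 * (L + 1) ≤ μ) (hdm : 2 * (L + 1) ≤ (d : ℝ) - r + μ) :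
    (hyperGen b d r).coeff (x + 1) ≤
      (1 + 4 * ((b : ℝ) + d + 2) * (L + 1) / W) * (hyperGen b d r).coeff x := by
  obtain ⟨hxb, hxr, hxd⟩ := window_support hx hbm hrm hdm
  set l : ℝ := ((x : ℝ) + 1) * ((d : ℝ) - r + x + 1) / (((b : ℝ) - x) * ((r : ℝ) - x)) with hl
  have hrat := coeff_hyperGen_div_coeff_succ (b := b) (d := d) (r := r) (x := x) (by omega) (by omega) (by omega)
  have hpos : 0 < (hyperGen b d r).coeff x := by
    rw [coeff_hyperGen, if_pos (by omega)]
    exact_mod_cast Nat.mul_pos (Nat.choose_pos (by omega)) (Nat.choose_pos (by omega))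
  have hpos1 : 0 < (hyperGen b d r).coeff (x + 1) := by
    rw [coeff_hyperGen, if_pos (by omega)]
    exact_mod_cast Nat.mul_pos (Nat.choose_pos (by omega)) (Nat.choose_pos (by omega))
  have hl0 : 0 < l := by rw [hl, ← hrat]; exact div_pos hpos hpos1
  -- `coeff (x+1) = l⁻¹ · coeff x`
  have hq : (hyperGen b d r).coeff (x + 1) = l⁻¹ * (hyperGen b d r).coeff x := by
    rw [hl, ← hrat, inv_div, div_mul_cancel₀ _ hpos.ne']
  have hbound := abs_one_sub_hyperRatio_inv_le hμ hW hl hx hbm hrm hμm hdm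
  have hle : l⁻¹ ≤ 1 + 4 * ((b : ℝ) + d + 2) * (L + 1) / W := by
    have := neg_abs_le (1 - l⁻¹)
    linarith
  rw [hq]
  exact mul_le_mul_of_nonneg_right hle hpos.le

/-- **One step down inside the window**: with `η = 4(N+2)(L+1)/W`, at every window point `x`,
`coeff_x H_{b,d,r} ≤ (1+η)·coeff_{x+1} H_{b,d,r}` (`coeff_x = λ(x)·coeff_{x+1}` and `λ(x) ≤ 1 + |1−λ(x)|`).
[cite: ChattamvelliShanmugam2020, §7.4 Table 7.1 (recurrence of the hypergeometric law)] -/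
theorem coeff_hyperGen_le_succ_of_window {b d r x : ℕ} {μ L W : ℝ}
    (hμ : μ = (r : ℝ) * b / ((b : ℝ) + d))
    (hW : W = (r : ℝ) * b * d * ((b : ℝ) + d - r) / ((b : ℝ) + d) ^ 2)
    (hx : |(x : ℝ) - μ| ≤ L)
    (hbm : 2 * (L + 1) ≤ (b : ℝ) - μ) (hrm : 2 * (L + 1) ≤ (r : ℝ) - μ)
    (hμm : 2 * (L + 1) ≤ μ) (hdm : 2 * (L + 1) ≤ (d : ℝ) - r + μ) :
    (hyperGen b d r).coeff x ≤
      (1 + 4 * ((b : ℝ) + d + 2) * (L + 1) / W) * (hyperGen b d r).coeff (x + 1) := by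
  obtain ⟨hxb, hxr, hxd⟩ := window_support hx hbm hrm hdm
  set l : ℝ := ((x : ℝ) + 1) * ((d : ℝ) - r + x + 1) / (((b : ℝ) - x) * ((r : ℝ) - x)) with hl
  have hrat := coeff_hyperGen_div_coeff_succ (b := b) (d := d) (r := r) (x := x) (by omega) (by omega) (by omega)
  have hpos1 : 0 < (hyperGen b d r).coeff (x + 1) := by
    rw [coeff_hyperGen, if_pos (by omega)]
    exact_mod_cast Nat.mul_pos (Nat.choose_pos (by omega)) (Nat.choose_pos (by omega))
  -- `coeff x = l · coeff (x+1)`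
  have hq : (hyperGen b d r).coeff x = l * (hyperGen b d r).coeff (x + 1) := by
    rw [hl, ← hrat, div_mul_cancel₀ _ hpos1.ne']
  have hbound := abs_one_sub_hyperRatio_le hμ hW hl hx hbm hrm hμm hdm
  have hle : l ≤ 1 + 4 * ((b : ℝ) + d + 2) * (L + 1) / W := by
    have := neg_abs_le (1 - l)
    linarith
  rw [hq]
  exact mul_le_mul_of_nonneg_right hle hpos1.le

/-- **TWO-SIDED GEOMETRIC ENVELOPE INSIDE THE WINDOW.** With `η = 4(N+2)(L+1)/W`: for window points
`x ≤ x'` (`|x−μ|, |x'−μ| ≤ L`, margins `2(L+1) ≤ b−μ, r−μ, μ, d−r+μ`),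
`coeff_{x'} H ≤ (1+η)^{x'−x}·coeff_x H` and `coeff_x H ≤ (1+η)^{x'−x}·coeff_{x'} H` — the one-step bounds
iterated along the interval `[x, x']`, which lies inside the window. (Ratio monotonicity / log-concavity
[Karlin 1968, Ch. 8 §1] is not needed here.)
[cite: ChattamvelliShanmugam2020, §7.4 Table 7.1 (recurrence of the hypergeometric law)] -/
theorem coeff_hyperGen_window_envelope {b d r x x' : ℕ} {μ L W : ℝ}
    (hμ : μ = (r : ℝ) * b / ((b : ℝ) + d))
    (hW : W = (r : ℝ) * b * d * ((b : ℝ) + d - r) / ((b : ℝ) + d) ^ 2)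
    (hx : |(x : ℝ) - μ| ≤ L) (hx' : |(x' : ℝ) - μ| ≤ L) (hxx' : x ≤ x')
    (hbm : 2 * (L + 1) ≤ (b : ℝ) - μ) (hrm : 2 * (L + 1) ≤ (r : ℝ) - μ)
    (hμm : 2 * (L + 1) ≤ μ) (hdm : 2 * (L + 1) ≤ (d : ℝ) - r + μ) :
    (hyperGen b d r).coeff x' ≤
        (1 + 4 * ((b : ℝ) + d + 2) * (L + 1) / W) ^ (x' - x) * (hyperGen b d r).coeff x ∧
      (hyperGen b d r).coeff x ≤
        (1 + 4 * ((b : ℝ) + d + 2) * (L + 1) / W) ^ (x' - x) * (hyperGen b d r).coeff x' := by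
  obtain ⟨k, rfl⟩ := Nat.exists_eq_add_of_le hxx'
  rw [Nat.add_sub_cancel_left]
  set ρ : ℝ := 1 + 4 * ((b : ℝ) + d + 2) * (L + 1) / W with hρ
  obtain ⟨hx1, hx2⟩ := abs_le.1 hx
  -- `ρ ≥ 1 ≥ 0`
  have hρ0 : 0 ≤ ρ := by
    have h := coeff_hyperGen_le_succ_of_window hμ hW hx hbm hrm hμm hdm
    obtain ⟨hxb, hxr, hxd⟩ := window_support hx hbm hrm hdm
    have hpos1 : 0 < (hyperGen b d r).coeff (x + 1) := by
      rw [coeff_hyperGen, if_pos (by omega)]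
      exact_mod_cast Nat.mul_pos (Nat.choose_pos (by omega)) (Nat.choose_pos (by omega))
    have h0 : 0 ≤ (hyperGen b d r).coeff x := by
      rw [coeff_hyperGen]; split_ifs <;> positivity
    by_contra hneg
    rw [not_le] at hneg
    have : ρ * (hyperGen b d r).coeff (x + 1) < 0 := mul_neg_of_neg_of_pos hneg hpos1
    linarith
  -- induction on the distance, every intermediate point being a window point
  induction k with
  | zero => simp
  | succ k ih =>
    have hxk' : |((x + k : ℕ) : ℝ) - μ| ≤ L := by
      obtain ⟨h1, h2⟩ := abs_le.1 hx'
      rw [abs_le]; push_cast at h1 h2 ⊢; constructor <;> linarith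
    have hxk1 : |((x + (k + 1) : ℕ) : ℝ) - μ| ≤ L := hx'
    obtain ⟨ih1, ih2⟩ := ih hxk' (Nat.le_add_right _ _)
    have hup := coeff_hyperGen_succ_le_of_window hμ hW hxk' hbm hrm hμm hdm
    have hdown := coeff_hyperGen_le_succ_of_window hμ hW hxk' hbm hrm hμm hdm
    rw [show x + (k + 1) = x + k + 1 by ring]
    refine ⟨?_, ?_⟩
    · calc (hyperGen b d r).coeff (x + k + 1) ≤ ρ * (hyperGen b d r).coeff (x + k) := hup
        _ ≤ ρ * (ρ ^ k * (hyperGen b d r).coeff x) := mul_le_mul_of_nonneg_left ih1 hρ0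
        _ = ρ ^ (k + 1) * (hyperGen b d r).coeff x := by ring
    · calc (hyperGen b d r).coeff x ≤ ρ ^ k * (hyperGen b d r).coeff (x + k) := ih2
        _ ≤ ρ ^ k * (ρ * (hyperGen b d r).coeff (x + k + 1)) :=
            mul_le_mul_of_nonneg_left hdown (pow_nonneg hρ0 _)
        _ = ρ ^ (k + 1) * (hyperGen b d r).coeff (x + k + 1) := by ring

/-! ## §4 The effective variance of the tilted law -/

/-- **`min(λ, λ⁻¹)·V ≥ V/(1+η)` on the window** (`η = 4(N+2)(L+1)/W`, `V ≥ 0` arbitrary): the effective variance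
`V' = min(λ,λ⁻¹)·V` of `hyperGen_abs_nabla_even_le` loses at most the factor `1+η` inside the window.
[cite: ChattamvelliShanmugam2020, §7.4 Table 7.1 (recurrence of the hypergeometric law)] -/
theorem le_min_hyperRatio_inv_mul {b d r x : ℕ} {μ L W V l : ℝ}
    (hμ : μ = (r : ℝ) * b / ((b : ℝ) + d))
    (hW : W = (r : ℝ) * b * d * ((b : ℝ) + d - r) / ((b : ℝ) + d) ^ 2)
    (hl : l = ((x : ℝ) + 1) * ((d : ℝ) - r + x + 1) / (((b : ℝ) - x) * ((r : ℝ) - x)))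
    (hx : |(x : ℝ) - μ| ≤ L)
    (hbm : 2 * (L + 1) ≤ (b : ℝ) - μ) (hrm : 2 * (L + 1) ≤ (r : ℝ) - μ)
    (hμm : 2 * (L + 1) ≤ μ) (hdm : 2 * (L + 1) ≤ (d : ℝ) - r + μ) (hV : 0 ≤ V) :
    V / (1 + 4 * ((b : ℝ) + d + 2) * (L + 1) / W) ≤ min l l⁻¹ * V := by
  obtain ⟨hxb, hxr, hxd⟩ := window_support hx hbm hrm hdm
  obtain ⟨hx1, hx2⟩ := abs_le.1 hx
  set η : ℝ := 4 * ((b : ℝ) + d + 2) * (L + 1) / W with hη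
  have h1 := abs_one_sub_hyperRatio_le hμ hW hl hx hbm hrm hμm hdm
  have h2 := abs_one_sub_hyperRatio_inv_le hμ hW hl hx hbm hrm hμm hdm
  -- `l > 0`
  have hl0 : 0 < l := by
    rw [hl]
    have hx0 : (0 : ℝ) ≤ x := Nat.cast_nonneg _
    have hxbR : (x : ℝ) + 2 ≤ b := by exact_mod_cast hxb
    have hxrR : (x : ℝ) + 2 ≤ r := by exact_mod_cast hxr
    have hxdR : (r : ℝ) + 2 ≤ (d : ℝ) + x := by exact_mod_cast hxd
    exact div_pos (mul_pos (by linarith) (by linarith)) (mul_pos (by linarith) (by linarith))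
  have hle1 : l ≤ 1 + η := by have := neg_abs_le (1 - l); rw [← hη] at h1; linarith
  have hle2 : l⁻¹ ≤ 1 + η := by have := neg_abs_le (1 - l⁻¹); rw [← hη] at h2; linarith
  have hη1 : 0 < 1 + η := hl0.trans_le hle1
  -- `1/(1+η) ≤ l` and `1/(1+η) ≤ l⁻¹`
  have hge1 : 1 / (1 + η) ≤ l := by
    rw [div_le_iff₀ hη1]
    have : l⁻¹ * l = 1 := inv_mul_cancel₀ hl0.ne'
    nlinarith [hle2, hl0]
  have hge2 : 1 / (1 + η) ≤ l⁻¹ := by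
    rw [div_le_iff₀ hη1]
    have : l * l⁻¹ = 1 := mul_inv_cancel₀ hl0.ne'
    nlinarith [hle1, inv_pos.2 hl0]
  calc V / (1 + η) = 1 / (1 + η) * V := by ring
    _ ≤ min l l⁻¹ * V := mul_le_mul_of_nonneg_right (le_min hge1 hge2) hV

/-! ## §5 The window lower bound: every window atom is within a factor `(1+η)^{L+2}` of the maximal atom -/

/-- **THE WINDOW LOWER BOUND.** For `2 ≤ L`, window margins `2(L+1) ≤ b−μ, r−μ, μ, d−r+μ`, a window point `x`
(`|x − μ| ≤ L`) and any natural number `n₀ ≥ L + 2`: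
`C(b+d,r)·3/(8(2√V+1)) ≤ (1+η)^{n₀}·coeff_x H_{b,d,r}`, `η = 4(N+2)(L+1)/W`,
`V = rbd(b+d−r)/((b+d)²(b+d−1))` — i.e. in law units `h(x) ≥ (1+η)^{−n₀}·3/(8(2√V+1))`. The maximal atom of the
law is `≥ 3/(8(2√V+1))` (Chebyshev + pigeonhole, `exists_max_pmf_ge`, through the Bernoulli-sum representation
of the hypergeometric law `exists_bernoulliProd_eq_hyperGen`), every maximiser lies within `2 ≤ L` of the mean
(`hyperGen_argmax_near_mean`), hence in the window, at distance `≤ L + 2 ≤ n₀` from `x`, and §3 applies.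
[cite: ChattamvelliShanmugam2020, §7.4 Table 7.1 (mode and recurrence of the hypergeometric law)]
[cite: VatutinMikhailov1983, §2] [cite: Durrett2019, Thm. 1.6.4 (Chebyshev's inequality)] -/
theorem coeff_hyperGen_window_lower {b d r x n₀ : ℕ} {μ L W V : ℝ}
    (hμ : μ = (r : ℝ) * b / ((b : ℝ) + d))
    (hW : W = (r : ℝ) * b * d * ((b : ℝ) + d - r) / ((b : ℝ) + d) ^ 2)
    (hVdef : V = (r : ℝ) * b * d * ((b : ℝ) + d - r) / (((b : ℝ) + d) ^ 2 * ((b : ℝ) + d - 1)))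
    (hL : 2 ≤ L) (hx : |(x : ℝ) - μ| ≤ L) (hn₀ : L + 2 ≤ n₀)
    (hbm : 2 * (L + 1) ≤ (b : ℝ) - μ) (hrm : 2 * (L + 1) ≤ (r : ℝ) - μ)
    (hμm : 2 * (L + 1) ≤ μ) (hdm : 2 * (L + 1) ≤ (d : ℝ) - r + μ) :
    (((b + d).choose r : ℕ) : ℝ) * (3 / (8 * (2 * Real.sqrt V + 1))) ≤
      (1 + 4 * ((b : ℝ) + d + 2) * (L + 1) / W) ^ n₀ * (hyperGen b d r).coeff x := by
  obtain ⟨hxb, hxr, hxd⟩ := window_support hx hbm hrm hdm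
  have hr : r ≤ b + d := by omega
  have hN : 0 < b + d := by omega
  set ρ : ℝ := 1 + 4 * ((b : ℝ) + d + 2) * (L + 1) / W with hρ
  -- the Bernoulli-sum representation and the maximal atom
  obtain ⟨ps, hps0, hlen, hG⟩ := exists_bernoulliProd_eq_hyperGen hr
  have hps : ∀ p ∈ ps, 0 ≤ p ∧ p ≤ 1 := fun p hp => ⟨(hps0 p hp).1.le, (hps0 p hp).2⟩
  have hVps : (ps.map fun p => p * (1 - p)).sum = V := by
    rw [hVdef]; exact sum_mul_one_sub_eq_of_hyperGen_eq hr hlen hG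
  set c : ℝ := (((b + d).choose r : ℕ) : ℝ) with hc
  have hc0 : 0 < c := by rw [hc]; exact_mod_cast Nat.choose_pos hr
  have hcoef : ∀ i, (hyperGen b d r).coeff i = c * pmf ps i := by
    intro i; rw [hG, coeff_C_mul, coeff_bernoulliProd_eq_pmf]
  obtain ⟨m, hmax, hmge⟩ := exists_max_pmf_ge ps hps
  rw [hVps] at hmge
  -- `m` maximises the coefficients of `H`, hence `|m − μ| ≤ 2 ≤ L`: `m` is a window point
  have hmaxH : ∀ i, (hyperGen b d r).coeff i ≤ (hyperGen b d r).coeff m := by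
    intro i; rw [hcoef, hcoef]; exact mul_le_mul_of_nonneg_left (hmax i) hc0.le
  have hm2 := hyperGen_argmax_near_mean hr hN hmaxH
  rw [← hμ] at hm2
  have hmL : |(m : ℝ) - μ| ≤ L := hm2.trans hL
  -- `c · 3/(8(2√V+1)) ≤ coeff m`
  have hcm : c * (3 / (8 * (2 * Real.sqrt V + 1))) ≤ (hyperGen b d r).coeff m := by
    rw [hcoef]; exact mul_le_mul_of_nonneg_left hmge hc0.le
  -- `ρ ≥ 1`
  have hρ1 : 1 ≤ ρ := by
    have hL0 : 0 ≤ L := by linarith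
    have hWc : ((b : ℝ) - μ) * ((r : ℝ) - μ) = W := by rw [hW]; exact sub_mean_mul_sub_mean_eq hN hμ
    have hWpos : 0 < W := by
      have : (L + 1) * (L + 1) ≤ ((b : ℝ) - μ) * ((r : ℝ) - μ) :=
        mul_le_mul (by linarith) (by linarith) (by linarith) (by linarith)
      nlinarith
    have : 0 ≤ 4 * ((b : ℝ) + d + 2) * (L + 1) / W := by positivity
    linarith
  -- the distance from `m` to `x` is at most `L + 2 ≤ n₀`
  obtain ⟨hx1, hx2⟩ := abs_le.1 hx
  obtain ⟨hm1', hm2'⟩ := abs_le.1 hm2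
  have hcoefx0 : 0 ≤ (hyperGen b d r).coeff x := by rw [coeff_hyperGen]; split_ifs <;> positivity
  rcases le_total m x with hmx | hxm
  · -- `m ≤ x`: `coeff m ≤ ρ^{x−m} coeff x ≤ ρ^{n₀} coeff x`
    obtain ⟨_, h2⟩ := coeff_hyperGen_window_envelope hμ hW hmL hx hmx hbm hrm hμm hdm
    have hdist : ((x - m : ℕ) : ℝ) ≤ n₀ := by
      rw [Nat.cast_sub hmx]; linarith
    have hpow : ρ ^ (x - m) ≤ ρ ^ n₀ := pow_le_pow_right₀ hρ1 (by exact_mod_cast hdist)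
    calc c * (3 / (8 * (2 * Real.sqrt V + 1))) ≤ (hyperGen b d r).coeff m := hcm
      _ ≤ ρ ^ (x - m) * (hyperGen b d r).coeff x := h2
      _ ≤ ρ ^ n₀ * (hyperGen b d r).coeff x := mul_le_mul_of_nonneg_right hpow hcoefx0
  · -- `x ≤ m`: `coeff m ≤ ρ^{m−x} coeff x ≤ ρ^{n₀} coeff x`
    obtain ⟨h1, _⟩ := coeff_hyperGen_window_envelope hμ hW hx hmL hxm hbm hrm hμm hdm
    have hdist : ((m - x : ℕ) : ℝ) ≤ n₀ := by
      rw [Nat.cast_sub hxm]; linarith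
    have hpow : ρ ^ (m - x) ≤ ρ ^ n₀ := pow_le_pow_right₀ hρ1 (by exact_mod_cast hdist)
    calc c * (3 / (8 * (2 * Real.sqrt V + 1))) ≤ (hyperGen b d r).coeff m := hcm
      _ ≤ ρ ^ (m - x) * (hyperGen b d r).coeff x := h1
      _ ≤ ρ ^ n₀ * (hyperGen b d r).coeff x := mul_le_mul_of_nonneg_right hpow hcoefx0

/-! ## §6 Outside the window: absolute bounds for differences by local mass, hence by tails -/

/-- **Triangle inequality for a backward difference**: for a polynomial `P` with nonnegative coefficients,
`|coeff_n((1−X)^m·P)| ≤ Σ_{i ≤ m} C(m,i)·coeff_{n−i}(P)` (terms with `i > n` absent) — from the tree's alternating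
expansion `coeff_one_sub_X_pow_mul`. [cite: RollinRoss2010, §3 (Lemma 3.1)] -/
theorem abs_coeff_one_sub_X_pow_mul_le_sum (P : ℝ[X]) (hP : ∀ k, 0 ≤ P.coeff k) (m n : ℕ) :
    |((1 - X) ^ m * P).coeff n| ≤
      ∑ i ∈ range (m + 1), (m.choose i : ℝ) * (if i ≤ n then P.coeff (n - i) else 0) := by
  rw [coeff_one_sub_X_pow_mul]
  refine (abs_sum_le_sum_abs _ _).trans (sum_le_sum fun i _ => ?_)
  rw [abs_mul, abs_mul, abs_pow, abs_neg, abs_one, one_pow, one_mul, Nat.abs_cast]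
  refine mul_le_mul_of_nonneg_left ?_ (Nat.cast_nonneg _)
  split_ifs with h
  · rw [abs_of_nonneg (hP _)]
  · simp

/-- **A difference deep in the UPPER tail is at most `2^m ×` the tail mass**: for `P` with nonnegative coefficients
and `deg P ≤ r`, if `τ ≤ n − m` then `|coeff_n((1−X)^m·P)| ≤ 2^m · Σ_{k ≤ r, τ ≤ k} coeff_k(P)` — every coefficient
`coeff_{n−i}`, `i ≤ m`, is one term of the tail sum, and `Σ_i C(m,i) = 2^m`. With `P = H_{b,d,r}` and `τ = μ + t`
this composes with `hyperGen_upperTail_le_exp` (the bad-component line of cell pnp-psdrank's MEMO-26 §7 Step 3).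
[cite: RollinRoss2010, §3 (Lemma 3.1)] -/
theorem abs_coeff_one_sub_X_pow_mul_le_two_pow_mul_upperTail (P : ℝ[X]) (hP : ∀ k, 0 ≤ P.coeff k) {r : ℕ}
    (hdeg : P.natDegree ≤ r) (m n : ℕ) {τ : ℝ} (hτ : τ ≤ (n : ℝ) - m) :
    |((1 - X) ^ m * P).coeff n| ≤
      2 ^ m * ∑ k ∈ (range (r + 1)).filter (fun k : ℕ => τ ≤ (k : ℝ)), P.coeff k := by
  set T := ∑ k ∈ (range (r + 1)).filter (fun k : ℕ => τ ≤ (k : ℝ)), P.coeff k with hT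
  have hT0 : 0 ≤ T := sum_nonneg fun k _ => hP k
  -- every term is at most `T`
  have hterm : ∀ i ∈ range (m + 1), (if i ≤ n then P.coeff (n - i) else 0) ≤ T := by
    intro i hi
    rw [mem_range] at hi
    split_ifs with h
    · by_cases hdeg' : n - i ≤ r
      · refine single_le_sum (f := fun k => P.coeff k) (fun k _ => hP k) ?_
        rw [mem_filter, mem_range]
        refine ⟨by omega, ?_⟩
        have : ((n - i : ℕ) : ℝ) = (n : ℝ) - i := by rw [Nat.cast_sub h]
        rw [this]
        have hi' : (i : ℝ) ≤ m := by exact_mod_cast Nat.lt_succ_iff.1 hi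
        linarith
      · rw [coeff_eq_zero_of_natDegree_lt (by omega)]
        exact hT0
    · exact hT0
  calc |((1 - X) ^ m * P).coeff n|
      ≤ ∑ i ∈ range (m + 1), (m.choose i : ℝ) * (if i ≤ n then P.coeff (n - i) else 0) :=
        abs_coeff_one_sub_X_pow_mul_le_sum P hP m n
    _ ≤ ∑ i ∈ range (m + 1), (m.choose i : ℝ) * T :=
        sum_le_sum fun i hi => mul_le_mul_of_nonneg_left (hterm i hi) (Nat.cast_nonneg _)
    _ = 2 ^ m * T := by
        rw [← sum_mul]
        congr 1
        have := Nat.sum_range_choose m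
        exact_mod_cast this

/-- **A difference deep in the LOWER tail is at most `2^m ×` the tail mass**: for `P` with nonnegative coefficients
and `deg P ≤ r`, if `n ≤ τ` then `|coeff_n((1−X)^m·P)| ≤ 2^m · Σ_{k ≤ r, k ≤ τ} coeff_k(P)`. With `P = H_{b,d,r}` and
`τ = μ − t` this composes with `hyperGen_lowerTail_le_exp`. [cite: RollinRoss2010, §3 (Lemma 3.1)] -/
theorem abs_coeff_one_sub_X_pow_mul_le_two_pow_mul_lowerTail (P : ℝ[X]) (hP : ∀ k, 0 ≤ P.coeff k) {r : ℕ}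
    (hdeg : P.natDegree ≤ r) (m n : ℕ) {τ : ℝ} (hτ : (n : ℝ) ≤ τ) :
    |((1 - X) ^ m * P).coeff n| ≤
      2 ^ m * ∑ k ∈ (range (r + 1)).filter (fun k : ℕ => (k : ℝ) ≤ τ), P.coeff k := by
  set T := ∑ k ∈ (range (r + 1)).filter (fun k : ℕ => (k : ℝ) ≤ τ), P.coeff k with hT
  have hT0 : 0 ≤ T := sum_nonneg fun k _ => hP k
  have hterm : ∀ i ∈ range (m + 1), (if i ≤ n then P.coeff (n - i) else 0) ≤ T := by
    intro i _
    split_ifs with h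
    · by_cases hdeg' : n - i ≤ r
      · refine single_le_sum (f := fun k => P.coeff k) (fun k _ => hP k) ?_
        rw [mem_filter, mem_range]
        refine ⟨by omega, ?_⟩
        have : ((n - i : ℕ) : ℝ) ≤ n := by exact_mod_cast Nat.sub_le n i
        linarith
      · rw [coeff_eq_zero_of_natDegree_lt (by omega)]
        exact hT0
    · exact hT0
  calc |((1 - X) ^ m * P).coeff n|
      ≤ ∑ i ∈ range (m + 1), (m.choose i : ℝ) * (if i ≤ n then P.coeff (n - i) else 0) :=
        abs_coeff_one_sub_X_pow_mul_le_sum P hP m n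
    _ ≤ ∑ i ∈ range (m + 1), (m.choose i : ℝ) * T :=
        sum_le_sum fun i hi => mul_le_mul_of_nonneg_left (hterm i hi) (Nat.cast_nonneg _)
    _ = 2 ^ m * T := by
        rw [← sum_mul]
        congr 1
        have := Nat.sum_range_choose m
        exact_mod_cast this

/-- **The hypergeometric instances** (the bad-component bounds of MEMO-26 §7 Step 3, ready to compose with
`hyperGen_upperTail_le_exp` / `hyperGen_lowerTail_le_exp`): for `τ ≤ n − m`,
`|coeff_n((1−X)^m H_{b,d,r})| ≤ 2^m Σ_{k ≤ r, τ ≤ k} coeff_k H`, and for `n ≤ τ`,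
`|coeff_n((1−X)^m H_{b,d,r})| ≤ 2^m Σ_{k ≤ r, k ≤ τ} coeff_k H`. [cite: VatutinMikhailov1983, §2]
[cite: RollinRoss2010, §3 (Lemma 3.1)] -/
theorem hyperGen_abs_nabla_le_two_pow_mul_tail (b d r m n : ℕ) (τ : ℝ) :
    (τ ≤ (n : ℝ) - m → |((1 - X) ^ m * hyperGen b d r).coeff n| ≤
      2 ^ m * ∑ k ∈ (range (r + 1)).filter (fun k : ℕ => τ ≤ (k : ℝ)), (hyperGen b d r).coeff k) ∧
    ((n : ℝ) ≤ τ → |((1 - X) ^ m * hyperGen b d r).coeff n| ≤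
      2 ^ m * ∑ k ∈ (range (r + 1)).filter (fun k : ℕ => (k : ℝ) ≤ τ), (hyperGen b d r).coeff k) :=
  ⟨fun hτ => abs_coeff_one_sub_X_pow_mul_le_two_pow_mul_upperTail _ (coeff_hyperGen_nonneg b d r)
      (natDegree_hyperGen_le b d r) m n hτ,
   fun hτ => abs_coeff_one_sub_X_pow_mul_le_two_pow_mul_lowerTail _ (coeff_hyperGen_nonneg b d r)
      (natDegree_hyperGen_le b d r) m n hτ⟩

end PoissonBinomial

end Literature.Probability.Distributions
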